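import Literature.Topology.FourManifolds.GompfFramedTwistOfShearModel
import HarnessLib

/-!
# F from fishtail twisting data in the shear model: arbitrary tube radius and twist map

A convenience form of `Literature.Topology.FourManifolds.gompf2010_framedTwist_of_shearModel`
(`GompfFramedTwistOfShearModel.lean`; R. Gompf, *More Cappell–Shaneson spheres are standard*, Algebr.
Geom. Topol. 10 (2010), Theorem 2.1 reduced to Lemma 2.2 in the shear model `X_𝔏`) for whoever
supplies the fishtail diffeomorphism: the product tube of `X_𝔏` may have **any admissible radius
`ε₀ < 1/3`** (with any proofs of admissibility, so that the surgered type is the supplier's own), and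
the twist across the sliver may be **any map `g` that agrees with `δ_rot = rotDehn` above the sliver on
the chosen neighbourhood `V_δ`** (e.g. a staircase twist `z₃ ↦ z₃ e^{2πiκ}` with `e^{2πiκ} = e^{i f(arg z₂)}`
there).

* `Literature.Topology.FourManifolds.gompf2010_framedTwist_of_shearModel_radius`.

Everything here is proved; no named facts are introduced.

## References

* R. E. Gompf, *More Cappell–Shaneson spheres are standard*, Algebr. Geom. Topol. 10 (2010)
  1665–1681: Thm 2.1 (proof), Lemma 2.2, §3 ¶1, §4 ¶3. [GompfAGT2010]
-/

open scoped Manifold ContDiff Topology Real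
open Set Function Metric Complex

noncomputable section

namespace Literature.Topology.FourManifolds

/-- Local notation: `𝔼 n` is the model Euclidean space `EuclideanSpace ℝ (Fin n)`. -/
local notation "𝔼 " n:arg => EuclideanSpace ℝ (Fin n)

/-- Local notation: the model with corners `𝓣 = (𝓡 1).prod ((𝓡 1).prod (𝓡 1))` of `ThreeTorus`. -/
local notation "𝓣" =>
  (ModelWithCorners.prod (𝓡 1) (ModelWithCorners.prod (𝓡 1) (𝓡 1)))

/-- `𝔏` is the identity on `expT (B̄(0, 8ε₀/7))` for `ε₀ < 1/3`. [folklore] -/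
theorem modelMonodromy_expT_of_le_contract {ε₀ : ℝ} (hε₀' : ε₀ < 1 / 3) (v : 𝔼 3)
    (hv : ‖v‖ ≤ contractScale ε₀ * 4) : modelMonodromy (expT v) = expT v :=
  modelMonodromy_expT v fun i ↦
    lt_of_le_of_lt ((Real.norm_eq_abs _).symm.le.trans (PiLp.norm_apply_le v i))
      (hv.trans_lt (by unfold contractScale; linarith))

/-- **The sliver twist only sees the twist map above the sliver on `V_δ`.** [folklore] -/
theorem sliverTwist_congr {g g' : ThreeTorus → ThreeTorus} {b : ThreeTorus × ↥mappingTorusPieceTwo}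
    (h : 1 < (b.2 : ℝ) → g b.1 = g' b.1) : sliverTwist g b = sliverTwist g' b := by
  by_cases h1 : 1 < (b.2 : ℝ)
  · rw [sliverTwist_of_one_lt g h1, sliverTwist_of_one_lt g' h1, h h1]
  · rw [sliverTwist_of_le_one g (not_lt.1 h1), sliverTwist_of_le_one g' (not_lt.1 h1)]

set_option maxHeartbeats 1600000 in
/-- **F from fishtail twisting data in the shear model — any tube radius, any matching twist map.**
Let `0 < ε₀ < 1/3` be a radius with `𝔏 = id` on `expT (B(0, ε₀))` (any proofs `hε₀π`, `hψ`), and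
suppose that for every thickness `0 < r ≤ r₀` there are `0 < τ < π/2`, `η > 0`, an open
neighbourhood `V_δ ⊆ T³ × (1 - η, 1 + η)` of the sliver `farSupport τ × {1}` missing the fibre through
`1` and stable under the sliver twist of `δ_rot⁻¹`, a map `g` of `T³` equal to `δ_rot` at the points
`y` with `(y, t) ∈ V_δ`, `t > 1`, and a diffeomorphism `G` of `prodSurgered 𝔏 ε₀` minus the sliver
twisting by `g` across the sliver on `V_δ` and the identity off a closed subset of the surgered
`twistNbhd 𝔏 η (axisTube r)`. Then F holds (`gompf2010_framedTwist_of_shearModel` after replacing `g`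
by `δ_rot` in the twisting property and reducing the radius). [cite: GompfAGT2010, Thm 2.1 (proof), Lemma 2.2, §3 ¶1, §4 ¶3] -/
theorem gompf2010_framedTwist_of_shearModel_radius {ε₀ : ℝ} (hε₀ : 0 < ε₀) (hε₀' : ε₀ < 1 / 3)
    (hε₀π : ε₀ ≤ π) (hψ : ∀ v : 𝔼 3, ‖v‖ < ε₀ → modelMonodromy (expT v) = expT v)
    {r₀ : ℝ} (hr₀ : 0 < r₀) (hr₀π : r₀ ≤ π)
    (hdata : ∀ (r : ℝ) (_ : 0 < r) (hrr₀ : r ≤ r₀),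
      ∃ (τ : ℝ) (hτ : 0 < τ) (hτ' : τ < π / 2) (η : ℝ) (_ : 0 < η)
        (Vδ : TopologicalSpace.Opens (ThreeTorus × ↥mappingTorusPieceTwo))
        (_ : fibreSliver (farSupport τ) ⊆ Vδ) (hV1 : ∀ b ∈ Vδ, b.1 ≠ 1)
        (_ : ∀ b ∈ Vδ, sliverTwist (rotDehn hτ hτ').symm b ∈ Vδ) (_ : ∀ b ∈ Vδ, b ∈ bicollarPiece η)
        (g : ThreeTorus → ThreeTorus)
        (_ : ∀ b ∈ Vδ, 1 < (b.2 : ℝ) → g b.1 = rotDehn hτ hτ' b.1)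
        (G : ↥((prodTube modelMonodromy ε₀ hε₀ hε₀π hψ).localOpens
            (prodSliverCompl modelMonodromy (isClosed_farSupport τ))) ≃ₘ⟮𝓡 4, 𝓡 4⟯
          ↥((prodTube modelMonodromy ε₀ hε₀ hε₀π hψ).localOpens
            (prodSliverCompl modelMonodromy (isClosed_farSupport τ))))
        (Ksupp : Set (prodSurgered modelMonodromy ε₀ hε₀ hε₀π hψ)),
        (∀ (x : ↥((prodTube modelMonodromy ε₀ hε₀ hε₀π hψ).localOpens
              (prodSliverCompl modelMonodromy (isClosed_farSupport τ))))
            (b : ↥Vδ), (b : ThreeTorus × ↥mappingTorusPieceTwo) ∉ fibreSliver (farSupport τ) →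
            (x : prodSurgered modelMonodromy ε₀ hε₀ hε₀π hψ) =
              (prodTube modelMonodromy ε₀ hε₀ hε₀π hψ).glueData.inl
                (opensToComplement (prodTube modelMonodromy ε₀ hε₀ hε₀π hψ) (mtGlueData modelMonodromy).inr Vδ
                  (inr_not_mem_range_secCircle_self modelMonodromy hε₀ hε₀π hψ Vδ hV1) b) →
            ∃ a' : ↥(prodTube modelMonodromy ε₀ hε₀ hε₀π hψ).complement,
              (a' : MTorus modelMonodromy) = (mtGlueData modelMonodromy).inr (sliverTwist g b) ∧
                (G x : prodSurgered modelMonodromy ε₀ hε₀ hε₀π hψ) =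
                  (prodTube modelMonodromy ε₀ hε₀ hε₀π hψ).glueData.inl a') ∧
        IsClosed Ksupp ∧
        Ksupp ⊆ (prodTube modelMonodromy ε₀ hε₀ hε₀π hψ).localOpens
          (twistNbhd modelMonodromy η (axisTube (hrr₀.trans hr₀π)) (Diffeotopy.refl 𝓣 ThreeTorus)
            (Diffeomorph.refl 𝓣 ThreeTorus ∞)) ∧
        ∀ x : ↥((prodTube modelMonodromy ε₀ hε₀ hε₀π hψ).localOpens
            (prodSliverCompl modelMonodromy (isClosed_farSupport τ))),
          (x : prodSurgered modelMonodromy ε₀ hε₀ hε₀π hψ) ∉ Ksupp → G x = x) :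
    gompf2010_framedTwist := by
  refine gompf2010_framedTwist_of_conjModel fun r hr hrr ↦ ?_
  have hrπ : r ≤ π := hrr.trans one_lt_pi'.le
  -- the data at thickness `min r r₀`
  obtain ⟨τ, hτ, hτ', η, hη, Vδ, hVS, hV1, hVg, hVη, g, hg, G, Ksupp, hG', hKc, hKU', hGK⟩ :=
    hdata (min r r₀) (lt_min hr hr₀) (min_le_right _ _)
  -- the twisting property with `δ_rot` in place of `g`
  have hG : ∀ (x : ↥((prodTube modelMonodromy ε₀ hε₀ hε₀π hψ).localOpens
        (prodSliverCompl modelMonodromy (isClosed_farSupport τ))))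
      (b : ↥Vδ), (b : ThreeTorus × ↥mappingTorusPieceTwo) ∉ fibreSliver (farSupport τ) →
      (x : prodSurgered modelMonodromy ε₀ hε₀ hε₀π hψ) =
        (prodTube modelMonodromy ε₀ hε₀ hε₀π hψ).glueData.inl
          (opensToComplement (prodTube modelMonodromy ε₀ hε₀ hε₀π hψ) (mtGlueData modelMonodromy).inr Vδ
            (inr_not_mem_range_secCircle_self modelMonodromy hε₀ hε₀π hψ Vδ hV1) b) →
      ∃ a' : ↥(prodTube modelMonodromy ε₀ hε₀ hε₀π hψ).complement,
        (a' : MTorus modelMonodromy) = (mtGlueData modelMonodromy).inr (sliverTwist (rotDehn hτ hτ') b) ∧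
          (G x : prodSurgered modelMonodromy ε₀ hε₀ hε₀π hψ) =
            (prodTube modelMonodromy ε₀ hε₀ hε₀π hψ).glueData.inl a' := by
    intro x b hbS hx
    obtain ⟨a', ha', hGx⟩ := hG' x b hbS hx
    refine ⟨a', ?_, hGx⟩
    rw [ha', sliverTwist_congr (g := g) (g' := ⇑(rotDehn hτ hτ')) (hg b b.2)]
  -- the support read in `twistNbhd 𝔏 η (axisTube r)`
  have hKU : Ksupp ⊆ (prodTube modelMonodromy ε₀ hε₀ hε₀π hψ).localOpens
      (twistNbhd modelMonodromy η (axisTube hrπ) (Diffeotopy.refl 𝓣 ThreeTorus) (Diffeomorph.refl 𝓣 ThreeTorus ∞)) :=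
    fun p hp ↦ CircleNbhd.localOpens_mono _ (fun x hx ↦ twistNbhd_mono modelMonodromy η (fun y hy ↦ by
      rw [mem_axisTube_iff] at hy ⊢
      exact ⟨hy.1.trans_le (min_le_left _ _), hy.2.trans_le (min_le_left _ _)⟩) _ _ hx) (hKU' hp)
  -- the radii
  have hR := radialR_pos shearC cPath
  obtain ⟨ε, hε, hεr2, hεR, hεε₀, hε2⟩ : ∃ ε : ℝ, 0 < ε ∧ ε ≤ r / 2 ∧ ε ≤ radialR shearC cPath ∧
      ε ≤ ε₀ ∧ ε ≤ 1 / 2 :=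
    ⟨min (r / 2) (min (radialR shearC cPath) (min ε₀ (1 / 2))),
      lt_min (by linarith) (lt_min hR (lt_min hε₀ (by norm_num))), min_le_left _ _,
      (min_le_right _ _).trans (min_le_left _ _),
      (min_le_right _ _).trans ((min_le_right _ _).trans (min_le_left _ _)),
      (min_le_right _ _).trans ((min_le_right _ _).trans (min_le_right _ _))⟩
  have hεr : ε < r := by linarith
  -- radius reduction `ε₀ ↦ ε`
  have hrad := exists_twistingDiffeo_radius modelMonodromy hε₀ hε₀' hε hεε₀ (modelMonodromy_expT_of_le_contract hε₀')
    hτ hτ' hη hεr hrπ Vδ hV1 hVη G hG Ksupp hKc hKU hGK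
  obtain ⟨G₁, K₁, hK₁c, hK₁U, hG₁K, hG₁⟩ := hrad
  -- conjugation by `C`
  have hconjC := exists_twistingDiffeo_shearC hτ hτ' hε hεR hε2 hη hεr hrπ (negVδ Vδ) (negVδ_fst_ne_one Vδ hV1)
    (fun b hb ↦ hVη b hb.1) G₁ hG₁ K₁ hK₁c hK₁U hG₁K
  obtain ⟨G₂, K₂, hK₂c, hK₂U, hG₂K, hG₂⟩ := hconjC
  refine ⟨ε, hε, le_pi_of_le_radialR hεR, hεr2, by linarith, conjModelMonodromy_expT_of_lt hε2, τ, hτ, hτ', η, hη,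
    cVδ (negVδ Vδ), fibreSliver_subset_cVδ hτ hτ' (fibreSliver_subset_negVδ hτ hτ' hVS),
    cVδ_fst_ne_one (negVδ_fst_ne_one Vδ hV1), fun b hb ↦ ?_, cVδ_subset_bicollar (fun b hb ↦ hVη b hb.1),
    G₂, K₂, hG₂, hK₂c, hK₂U, hG₂K⟩
  exact sliverTwist_farDehn_symm_mem_cVδ hτ hτ'
    (fun b hb ↦ sliverTwist_mem_negVδ (g := ⇑(rotDehn hτ hτ').symm) (fun y ↦ rfl) hVg hb) b hb

end Literature.Topology.FourManifolds
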